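import Summits.QuantumFields.YangMills.Theorems.UV3BranchExpansionDomination
import Summits.QuantumFields.YangMills.Theorems.BalabanUVNodesN08HaarCompatibilityGuardHybridPartition
import Literature.MathematicalPhysics.QuantumFieldTheory.Balaban1983to89.T4AvgSensitivity
import HarnessLib

/-!
# UV3 ∕ N08 supply — BRANCH (MÖBIUS) EXPANSION, MODEL INSTANTIATION OF (E): the guarded tower `iterFrom (blockAvg ℰ) j n` of print's (0.4) averaging
# IS the «actual composite» of ✓`UV3BranchExpansionDomination`, with hybrid trajectories as the branches and the guards `Small ℰ` as the switch events

LEAD seat `ym-ust-19936-w1` (gen 12) of crux stmt-QuantumFields-19936 `UnitScaleTilt.HistoryTailL`, cell `ym3-torus`; design note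
`Cruxes/HistoryTailL/HTopBranchExpansion.md` v1.2 §2∕§6 (19936 evidence #49∕#55).  RECORD CURRENCY (★★OWNER WORDS 84∕85): record-independent kinematics of the
guarded averaging (any `Params`, any group with the lit carrier instances, any small-loop average `ℰ`); read by NO row and NO concluder of the χ-record
`AlphaInputsT3ACv4RecChi`; SUPPLY for NODE O B3 (A-rows `fibre55Win`∕`fibre57LowOn`) and Track A's N08.  Nothing of hTop, of the record, of `HistoryTailL` or of
rung R3 is proved here; rung R3 = SU(2) YM₃ on T³ — NOT d = 4, NOT infinite volume, NOT a mass gap, NOT the Clay problem.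

THE POINT.  ✓`UV3BranchExpansionDomination.map_actual_le_smul_of_branchExpansion` is stated for an abstract «actual composite» `A ω = Φ (S ω) ω` whose actual history
`S` is characterised by `S ω = s ↔ ∀ σ, (σ ∈ s ↔ ω ∈ F σ s)`.  This file DISCHARGES that characterisation for the model: switch sites `σ = ⟨i, c⟩`, `i < n`,
`c ∈ PBond P (j+i+1)`; for a history `s` (a finset of sites) the HYBRID TRAJECTORY `V s i : GaugeField P j G → GaugeField P (j+i) G` (hypothesis-specified recursion
`hV0`∕`hVs`: at step `i` the typed (0.4) averaging `avgFun ℰ` on the slice of `s`, the straight transporter `axialAvg` off it — n08-w3's hybrid `Ū^{s_i}`), the events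
`F ⟨i,c⟩ s := {U | Small ℰ (V s i U) c}` and `Φ s := V s n`; the actual composite is lit `T4AvgSensitivity.iterFrom (fun k => blockAvg ℰ) j n`.
* §1 `hybrid_eq_avgFun_of_small_imp_mem` — one step: the hybrid on `S` IS print's guarded averaging as soon as every guarded bond lies in `S` (`avgFun = axialAvg` off the guard,
  lit ✓`avgFun_of_not_small`).
* §2 ★ `traj_eq_iterFrom_of_consistent` — if, below level `i`, the history `s` records exactly the guards that fire ALONG ITS OWN trajectory, then the trajectory IS the
  guarded tower up to level `i` (induction on `i`).
* §3 ★★ `history_eq_iff` — THE CHARACTERISATION `hS`: the actual history (the guards firing along the guarded tower) equals `s` iff `∀ σ, (σ ∈ s ↔ Small ℰ (V s σ.1 ·) σ.2)`;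
  ★ `iterFrom_eq_traj_history` — `hA`.
* §4 measurability: `measurable_traj`, `measurableSet_smallAlong`.
* §5 ★★★ `map_iterFrom_le_smul_of_branchExpansion` — **the domination letter AT THE MODEL**: for every mute class `𝓜` of histories (pairing hypothesis in the letters
  `F`, `Φ` above — discharged by (F-M2) over ✓`UV3BranchExpansionOneSlotField`) and weights `w` (discharged by (A): ✓p758345 ∘ ✓p759004 stacked by ✓`…_of_lt`),
  `(dU_j).map (iterFrom (fun k => blockAvg ℰ) j n) ≤ (Σ_{s ∉ 𝓜} 2^{|s|}·w s) • ν`.  At `ν = dU_{j+n}` and with (C′)'s count this is hTop's inequality for the segment `(j, n)`.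
[folklore] bookkeeping over lit `BlockAveraging`∕`AveragingRT`∕`T4AvgSensitivity` and the abstract (E); 0 `sorry`, 0 `def`, 0 `instance`; standard axioms.
-/

set_option autoImplicit false

noncomputable section

open MeasureTheory Set Function
open scoped ENNReal

namespace Summit.QuantumFields.YangMills.Theorems.UV3BranchExpansionGuardedTower

open Literature.MathematicalPhysics.QuantumFieldTheory.Balaban1983to89
open Literature.MathematicalPhysics.QuantumFieldTheory.Balaban1983to89.AveragingRT (axialAvg)
open Literature.MathematicalPhysics.QuantumFieldTheory.Balaban1983to89.BlockAveraging (Small avgFun blockAvg blockAvg_avg measurableSet_small)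
open Literature.MathematicalPhysics.QuantumFieldTheory.Balaban1983to89.BlockAveragingHaarAC (avgFun_of_not_small)
open Literature.MathematicalPhysics.QuantumFieldTheory.Balaban1983to89.T4AvgSensitivity (iterFrom iterFrom_zero iterFrom_succ)
open Summit.QuantumFields.YangMills.BalabanUVNodes.N08HaarCompatibilityGuardHybridPartition (measurable_hybrid)
open Summit.QuantumFields.YangMills.Theorems.UV3BranchExpansionDomination (map_actual_le_smul_of_branchExpansion)

variable {P : Params} [∀ k, DecidableEq (PBond P k)] {G : Type*} [GaugeGroup G] (ℰ : LoopAverage G) (j n : ℕ)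

/-! ## §1 One step: the hybrid is the guarded averaging when every firing guard is in the slice -/

/-- **ONE STEP**: if every bond whose guard fires at `W` lies in `S`, the hybrid «`avgFun` on `S`, `axialAvg` off `S`» equals print's guarded averaging `avgFun ℰ W`
(off the guard `avgFun = axialAvg`, lit ✓`avgFun_of_not_small`). [cite: Balaban1987RG1, (0.4) p.253] -/
theorem hybrid_eq_avgFun_of_small_imp_mem {k : ℕ} (W : GaugeField P k G) (S : Finset (PBond P (k + 1))) (h : ∀ c, Small ℰ W c → c ∈ S) :
    (fun c => if c ∈ S then avgFun ℰ W c else axialAvg W c : GaugeField P (k + 1) G) = avgFun ℰ W := by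
  funext c
  by_cases hc : c ∈ S
  · rw [if_pos hc]
  · rw [if_neg hc, avgFun_of_not_small ℰ W c fun hs => hc (h c hs)]

/-! ## §2 The hybrid trajectory of a history consistent with its own guards is the guarded tower -/

section Trajectory

variable (V : Finset (Σ i : Fin n, PBond P (j + i + 1)) → (i : ℕ) → GaugeField P j G → GaugeField P (j + i) G)

/-- ★ **CONSISTENT BELOW `i₀` ⇒ EQUAL TO THE TOWER UP TO `i₀`**: if for every level `i < i₀` (`i < n`) the slice of the history `s` is exactly the set of bonds whose
guard fires at the trajectory's own level-`i` field, then `V s i₀ U = iterFrom (blockAvg ℰ) j i₀ U`. [cite: Balaban1987RG1, (0.4) p.253] -/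
theorem traj_eq_iterFrom_of_consistent (hV0 : ∀ s U, V s 0 U = U)
    (hVs : ∀ s (i : ℕ) (hi : i < n) U, V s (i + 1) U = fun c =>
      if c ∈ (Finset.univ.filter fun c' => (⟨⟨i, hi⟩, c'⟩ : Σ i : Fin n, PBond P (j + i + 1)) ∈ s) then avgFun ℰ (V s i U) c else axialAvg (V s i U) c)
    (s : Finset (Σ i : Fin n, PBond P (j + i + 1))) (U : GaugeField P j G) :
    ∀ i₀ : ℕ, i₀ ≤ n → (∀ (i : ℕ) (hi : i < n), i < i₀ → ∀ c : PBond P (j + i + 1),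
      ((⟨⟨i, hi⟩, c⟩ : Σ i : Fin n, PBond P (j + i + 1)) ∈ s ↔ Small ℰ (V s i U) c)) →
      V s i₀ U = iterFrom (fun k => blockAvg (P := P) (j := k) ℰ) j i₀ U
  | 0, _, _ => (hV0 s U).trans (iterFrom_zero _ j U).symm
  | i₀ + 1, hi₀, hcons => by
    have hi : i₀ < n := Nat.lt_of_succ_le hi₀
    have ih := traj_eq_iterFrom_of_consistent hV0 hVs s U i₀ hi.le fun i hi' hlt c => hcons i hi' (Nat.lt_succ_of_lt hlt) c
    rw [hVs s i₀ hi U, iterFrom_succ, blockAvg_avg, ← ih]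
    refine hybrid_eq_avgFun_of_small_imp_mem ℰ (V s i₀ U) _ fun c hc => ?_
    exact Finset.mem_filter.2 ⟨Finset.mem_univ _, (hcons i₀ hi (Nat.lt_succ_self _) c).2 hc⟩

/-! ## §3 The characterisation of the actual history (`hS`) and the actual composite (`hA`) -/

/-- ★★ **`hS` FOR THE GUARDED TOWER**: the set of switch sites whose guard fires along the guarded tower equals `s` iff `s` is consistent with its own hybrid
trajectory: `∀ σ, (σ ∈ s ↔ Small ℰ (V s σ.1 U) σ.2)`. [cite: Balaban1987RG1, (0.4) p.253] -/
theorem history_eq_iff (hV0 : ∀ s U, V s 0 U = U)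
    (hVs : ∀ s (i : ℕ) (hi : i < n) U, V s (i + 1) U = fun c =>
      if c ∈ (Finset.univ.filter fun c' => (⟨⟨i, hi⟩, c'⟩ : Σ i : Fin n, PBond P (j + i + 1)) ∈ s) then avgFun ℰ (V s i U) c else axialAvg (V s i U) c)
    (U : GaugeField P j G) (s : Finset (Σ i : Fin n, PBond P (j + i + 1)))
    (Sact : Finset (Σ i : Fin n, PBond P (j + i + 1)))
    (hSact : ∀ σ : Σ i : Fin n, PBond P (j + i + 1), σ ∈ Sact ↔ Small ℰ (iterFrom (fun k => blockAvg (P := P) (j := k) ℰ) j σ.1 U) σ.2) :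
    Sact = s ↔ ∀ σ : Σ i : Fin n, PBond P (j + i + 1), (σ ∈ s ↔ Small ℰ (V s σ.1 U) σ.2) := by
  constructor
  · intro hS
    subst hS
    -- along the actual history the trajectory is the tower at every level
    have htow : ∀ i₀, i₀ ≤ n → V Sact i₀ U = iterFrom (fun k => blockAvg (P := P) (j := k) ℰ) j i₀ U := by
      intro i₀ hi₀
      induction i₀ with
      | zero => exact (hV0 _ U).trans (iterFrom_zero _ j U).symm
      | succ i ih =>
        have hi : i < n := Nat.lt_of_succ_le hi₀
        have ih' := ih hi.le
        rw [hVs Sact i hi U, iterFrom_succ, blockAvg_avg, ← ih']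
        refine hybrid_eq_avgFun_of_small_imp_mem ℰ (V Sact i U) _ fun c hc => Finset.mem_filter.2 ⟨Finset.mem_univ _, ?_⟩
        rw [hSact]
        show Small ℰ (iterFrom (fun k => blockAvg (P := P) (j := k) ℰ) j i U) c
        rw [← ih']
        exact hc
    intro σ
    rw [hSact, ← htow σ.1 (Nat.le_of_lt σ.1.isLt)]
  · intro hcons
    have htow : ∀ i₀, i₀ ≤ n → V s i₀ U = iterFrom (fun k => blockAvg (P := P) (j := k) ℰ) j i₀ U := fun i₀ hi₀ =>
      traj_eq_iterFrom_of_consistent ℰ j n V hV0 hVs s U i₀ hi₀ fun i hi _ c => hcons ⟨⟨i, hi⟩, c⟩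
    ext σ
    rw [hSact, hcons σ, htow σ.1 (Nat.le_of_lt σ.1.isLt)]

/-- ★ **`hA` FOR THE GUARDED TOWER**: the guarded tower is the hybrid trajectory of its own firing history. [cite: Balaban1987RG1, (0.4) p.253] -/
theorem iterFrom_eq_traj_history (hV0 : ∀ s U, V s 0 U = U)
    (hVs : ∀ s (i : ℕ) (hi : i < n) U, V s (i + 1) U = fun c =>
      if c ∈ (Finset.univ.filter fun c' => (⟨⟨i, hi⟩, c'⟩ : Σ i : Fin n, PBond P (j + i + 1)) ∈ s) then avgFun ℰ (V s i U) c else axialAvg (V s i U) c)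
    (U : GaugeField P j G) (Sact : Finset (Σ i : Fin n, PBond P (j + i + 1)))
    (hSact : ∀ σ : Σ i : Fin n, PBond P (j + i + 1), σ ∈ Sact ↔ Small ℰ (iterFrom (fun k => blockAvg (P := P) (j := k) ℰ) j σ.1 U) σ.2) :
    iterFrom (fun k => blockAvg (P := P) (j := k) ℰ) j n U = V Sact n U :=
  (traj_eq_iterFrom_of_consistent ℰ j n V hV0 hVs Sact U n le_rfl fun i hi _ c =>
    (history_eq_iff ℰ j n V hV0 hVs U Sact Sact hSact).1 rfl ⟨⟨i, hi⟩, c⟩).symm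

end Trajectory

/-! ## §4 Measurability of the trajectories and of the switch events -/

section Measurable

variable [MeasurableSpace G] [RegularGaugeGroup G]
  (V : Finset (Σ i : Fin n, PBond P (j + i + 1)) → (i : ℕ) → GaugeField P j G → GaugeField P (j + i) G)

/-- The hybrid trajectory is measurable at every level it is specified on (n08-w3 ✓`measurable_hybrid`). [folklore] -/
theorem measurable_traj (hE : ∀ m, Measurable fun W : Fin (m + 1) → G => ℰ.E W) (hV0 : ∀ s U, V s 0 U = U)
    (hVs : ∀ s (i : ℕ) (hi : i < n) U, V s (i + 1) U = fun c =>
      if c ∈ (Finset.univ.filter fun c' => (⟨⟨i, hi⟩, c'⟩ : Σ i : Fin n, PBond P (j + i + 1)) ∈ s) then avgFun ℰ (V s i U) c else axialAvg (V s i U) c)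
    (s : Finset (Σ i : Fin n, PBond P (j + i + 1))) : ∀ i, i ≤ n → Measurable (V s i)
  | 0, _ => by
    have h : V s 0 = id := funext (hV0 s)
    rw [h]; exact measurable_id
  | i + 1, hi => by
    have hi' : i < n := Nat.lt_of_succ_le hi
    have h : V s (i + 1) = (fun W : GaugeField P (j + i) G => (fun c =>
        if c ∈ (Finset.univ.filter fun c' => (⟨⟨i, hi'⟩, c'⟩ : Σ i : Fin n, PBond P (j + i + 1)) ∈ s) then avgFun ℰ W c else axialAvg W c :
          GaugeField P (j + i + 1) G)) ∘ V s i := funext (hVs s i hi')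
    rw [h]
    exact (measurable_hybrid ℰ hE _).comp (measurable_traj hE hV0 hVs s i hi'.le)

/-- The switch events `{U | Small ℰ (V s i U) c}` are measurable (lit ✓`measurableSet_small`). [folklore] -/
theorem measurableSet_smallAlong (hE : ∀ m, Measurable fun W : Fin (m + 1) → G => ℰ.E W) (hV0 : ∀ s U, V s 0 U = U)
    (hVs : ∀ s (i : ℕ) (hi : i < n) U, V s (i + 1) U = fun c =>
      if c ∈ (Finset.univ.filter fun c' => (⟨⟨i, hi⟩, c'⟩ : Σ i : Fin n, PBond P (j + i + 1)) ∈ s) then avgFun ℰ (V s i U) c else axialAvg (V s i U) c)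
    (s : Finset (Σ i : Fin n, PBond P (j + i + 1))) (σ : Σ i : Fin n, PBond P (j + i + 1)) :
    MeasurableSet {U : GaugeField P j G | Small ℰ (V s σ.1 U) σ.2} :=
  (measurableSet_small ℰ σ.2).preimage (measurable_traj ℰ j n V hE hV0 hVs s σ.1 (Nat.le_of_lt σ.1.isLt))

end Measurable

/-! ## §5 The domination letter at the model -/

section Domination

variable [MeasurableSpace G] [RegularGaugeGroup G] [HaarData G]
  (V : Finset (Σ i : Fin n, PBond P (j + i + 1)) → (i : ℕ) → GaugeField P j G → GaugeField P (j + i) G)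

/-- ★★★ **THE BRANCH-EXPANSION DOMINATION FOR THE GUARDED TOWER** `iterFrom (blockAvg ℰ) j n` (no standing-range hypothesis is needed for the identity itself): for every class `𝓜` of histories each of
which has a MUTE site `σ ∈ s` — flipping `σ`'s branch leaves `dU_j((⋂_{τ∈s} {Small along ·}) ∩ (V · n)⁻¹B)` unchanged — and weights `w s` dominating
`((dU_j)↾⋂_{τ∈s}{Small ℰ (V s' τ.1 ·) τ.2}).map (V s' n) ≤ w s • ν` for `s ∉ 𝓜`, `s' ⊆ s`:
`(dU_j).map (iterFrom (blockAvg ℰ) j n) ≤ (Σ_{s ∉ 𝓜} 2^{|s|}·w s) • ν` — ✓`map_actual_le_smul_of_branchExpansion` with `hS`∕`hA` discharged by §3. [cite: Balaban1987RG1, (0.4) p.253 (the typed averaging; bookkeeping)] -/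
theorem map_iterFrom_le_smul_of_branchExpansion (hE : ∀ m, Measurable fun W : Fin (m + 1) → G => ℰ.E W)
    (hV0 : ∀ s U, V s 0 U = U)
    (hVs : ∀ s (i : ℕ) (hi : i < n) U, V s (i + 1) U = fun c =>
      if c ∈ (Finset.univ.filter fun c' => (⟨⟨i, hi⟩, c'⟩ : Σ i : Fin n, PBond P (j + i + 1)) ∈ s) then avgFun ℰ (V s i U) c else axialAvg (V s i U) c)
    (𝓜 : Finset (Finset (Σ i : Fin n, PBond P (j + i + 1))))
    (hM : ∀ s ∈ 𝓜, ∃ σ ∈ s, ∀ s' ⊆ s, σ ∉ s' → ∀ B : Set (GaugeField P (j + n) G), MeasurableSet B →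
      fieldMeasure P j G ((⋂ τ ∈ s, {U : GaugeField P j G | Small ℰ (V (insert σ s') τ.1 U) τ.2}) ∩ V (insert σ s') n ⁻¹' B) =
        fieldMeasure P j G ((⋂ τ ∈ s, {U : GaugeField P j G | Small ℰ (V s' τ.1 U) τ.2}) ∩ V s' n ⁻¹' B))
    (ν : Measure (GaugeField P (j + n) G)) (w : Finset (Σ i : Fin n, PBond P (j + i + 1)) → ℝ≥0∞)
    (hw : ∀ s, s ∉ 𝓜 → ∀ s' ⊆ s, ∀ B : Set (GaugeField P (j + n) G), MeasurableSet B →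
      fieldMeasure P j G ((⋂ τ ∈ s, {U : GaugeField P j G | Small ℰ (V s' τ.1 U) τ.2}) ∩ V s' n ⁻¹' B) ≤ w s * ν B) :
    (fieldMeasure P j G).map (iterFrom (fun k => blockAvg (P := P) (j := k) ℰ) j n) ≤
      (∑ s ∈ Finset.univ \ 𝓜, 2 ^ s.card * w s) • ν := by
  classical
  haveI : IsFiniteMeasure (fieldMeasure P j G) := by infer_instance
  -- the actual history, as a finset-valued function of the finest field
  set S : GaugeField P j G → Finset (Σ i : Fin n, PBond P (j + i + 1)) := fun U =>
    Finset.univ.filter fun σ => Small ℰ (iterFrom (fun k => blockAvg (P := P) (j := k) ℰ) j σ.1 U) σ.2 with hSdef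
  have hSact : ∀ (U : GaugeField P j G) (σ : Σ i : Fin n, PBond P (j + i + 1)),
      σ ∈ S U ↔ Small ℰ (iterFrom (fun k => blockAvg (P := P) (j := k) ℰ) j σ.1 U) σ.2 := fun U σ => by
    simp only [hSdef, Finset.mem_filter, Finset.mem_univ, true_and]
  refine map_actual_le_smul_of_branchExpansion (fieldMeasure P j G) (fun s => V s n)
    (fun σ s => {U : GaugeField P j G | Small ℰ (V s σ.1 U) σ.2}) S (iterFrom (fun k => blockAvg (P := P) (j := k) ℰ) j n)
    (fun s => measurable_traj ℰ j n V hE hV0 hVs s n le_rfl) (fun σ s => measurableSet_smallAlong ℰ j n V hE hV0 hVs s σ)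
    (fun U s => ?_) (fun U => iterFrom_eq_traj_history ℰ j n V hV0 hVs U (S U) (hSact U)) 𝓜 hM ν w hw
  exact history_eq_iff ℰ j n V hV0 hVs U s (S U) (hSact U)

end Domination

end Summit.QuantumFields.YangMills.Theorems.UV3BranchExpansionGuardedTower

end
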